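import Literature.NumberTheory.NumberFields.ClassGroupRankEqualityCyclotomicTowerSaturated
import Literature.NumberTheory.IwasawaTheory.ClassicalMuVanishesIffBoundedRank
import Literature.NumberTheory.IwasawaTheory.ClassicalMuVanishesSubextension
import Literature.NumberTheory.IwasawaTheory.ClassicalMuVanishesReflectionLayer
import HarnessLib

/-!
# The rank-equality transfer, III: LEAF form — `μ_p(L₀^H) = 0 ⟺ μ_p(L₀^{H′}) = 0` when `rank_p Cl(L₀^H) = rank_p Cl(L₀^{H′})`
# (identification of the fixed fields `(L₀K_n)^{H̃_n}` with the layers of the cyclotomic tower of `L₀^H`)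

Topic `NumberTheory/NumberFields` (namespace = path, grouping sub-namespace `RankEqualityTransfer`).  THEOREM-ONLY file (no definition,
no named fact, no `sorry`), written by the prover seat `bsd-potss-k8t-c4` g25 (cell `bsd-potss`; `--supports` stmt-BirchSwinnertonDyer-19982;
closes nothing; neither BSD nor Conjecture A for any curve).  Consumer step of `ClassGroupRankEqualityCyclotomicTower{,Saturated}.lean`:

* `fixedField_layerImage_eq_restrict` — for `S ≤ G = Gal(L₀/k)` and `S̃_n ≤ Gal(L₀K_n/k)` the restrictions of
  `{τ ∈ Gal(k̄/K_n) : τ|_{L₀} ∈ S}`: `(L₀K_n)^{S̃_n} = j(L₀^S)·K_n` inside `L₀K_n` (pointwise fixing + the degree count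
  `[L₀K_n : k] = [L₀ : k]·pⁿ`, tree `finrank_fieldRange_sup_layer`, and `#S̃_n = #S`);
* `natCard_torsion_fixedField_layerImage_eq_pow` — hence `#Cl((L₀K_n)^{S̃_n})[p] = p ^ rank_p Cl((L₀^S·K_∞)_n)` (layer of the restricted
  tower `κ|_{L₀^S}`, tree `nonempty_algEquiv_layer_restrict_fieldRange_sup_layer`, `natCard_torsion_classGroup_layer_eq`);
* `classGroupPRank_restrict_fixedField_eq_of_saturated` — with `natCard_torsion_classGroup_fixedField_layer_eq_of_saturated`:
  **`rank_p Cl((L₀^H K_∞)_n) = rank_p Cl((L₀^{H′}K_∞)_n)` for every `n`**;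
* `classicalMuVanishes_restrict_fixedField_iff_of_saturated`, `classicalMuVanishes_of_isCyclotomic_fixedField_of_saturated` — **`μ = 0` for the
  cyclotomic `ℤ_p`-extensions of `L₀^{H′}` implies `μ = 0` for those of `L₀^H`** (bounded ranks, tree
  `classicalMuVanishes_iff_exists_forall_classGroupPRank_le`).

HYPOTHESES throughout: `k` number field, `p` odd, `κ` a `ℤ_p`-extension of `k` with a totally ramified prime (`k = ℚ` cyclotomic: tree),
`L₀ ⊆ k̄` finite Galois, `p ∤ [L₀ : k]`, `H ≤ H′`, `#Cl(L₀^H)[p] = #Cl(L₀^{H′})[p]`, and the saturated inertia condition `g h′ ∈ I(𝔮) g H`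
for the primes `𝔮 ∋ p` of `L₀` (e.g. `H′ ⊆ (I(𝔮) ∩ Z(G))·H`).

## References

* L. C. Washington, *Introduction to Cyclotomic Fields*, 2nd ed., GTM 83 (1997), §13.1, §13.3 (Prop. 13.23). [Washington1997]
* J. Neukirch, *Algebraic Number Theory* (1999), Ch. III §1 Prop. (1.6). [NeukirchANT1999]
-/

noncomputable section

open scoped Pointwise nonZeroDivisors
open NumberField Field IntermediateField Ideal IsDedekindDomain
open Literature.NumberTheory.GaloisRepresentations
open Literature.NumberTheory.EllipticCurves (ringOfIntegersToIntegralClosure ZpExtension)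
open Literature.NumberTheory.EllipticCurves.ZpExtension
open Literature.RepresentationTheory.FiniteGroups Literature.GroupTheory.FiniteAbelian Literature.NumberTheory.IwasawaTheory

namespace Literature.NumberTheory.NumberFields

namespace RankEqualityTransfer

variable {k : Type} [Field k]

/-- `((τ|_E) x : k̄) = τ • x`. [folklore] -/
private theorem coe_absRestrictNormalHom_apply₆ (E : IntermediateField k (AlgebraicClosure k))
    [Normal k E] (τ : absoluteGaloisGroup k) (x : E) :
    ((absRestrictNormalHom E τ x : E) : AlgebraicClosure k) = τ • (x : AlgebraicClosure k) :=
  AlgEquiv.restrictNormalHom_apply E _ x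

/-- `τ|_E = 1` iff `τ ∈ Gal(k̄/E)`. [folklore] -/
private theorem absRestrictNormalHom_eq_one_iff_mem_fixingSubgroup₆
    (E : IntermediateField k (AlgebraicClosure k)) [Normal k E] (τ : absoluteGaloisGroup k) :
    absRestrictNormalHom E τ = 1 ↔ absoluteGaloisGroup.toAlgEquiv k τ ∈ E.fixingSubgroup := by
  rw [IntermediateField.mem_fixingSubgroup_iff]
  constructor
  · intro h x hx
    change τ • x = x
    rw [← coe_absRestrictNormalHom_apply₆ E τ ⟨x, hx⟩, h, AlgEquiv.one_apply]
  · intro h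
    ext x
    rw [coe_absRestrictNormalHom_apply₆ E τ x, AlgEquiv.one_apply]
    exact h x x.2

/-- `σ|_{E₁E₂} = τ|_{E₁E₂} ↔ σ|_{E₁} = τ|_{E₁} ∧ σ|_{E₂} = τ|_{E₂}`. [folklore] -/
private theorem absRestrictNormalHom_sup_eq_iff₆ (E₁ E₂ : IntermediateField k (AlgebraicClosure k))
    [Normal k E₁] [Normal k E₂] (σ τ : absoluteGaloisGroup k) :
    absRestrictNormalHom (E₁ ⊔ E₂ : IntermediateField k (AlgebraicClosure k)) σ =
        absRestrictNormalHom (E₁ ⊔ E₂ : IntermediateField k (AlgebraicClosure k)) τ ↔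
      absRestrictNormalHom E₁ σ = absRestrictNormalHom E₁ τ ∧ absRestrictNormalHom E₂ σ = absRestrictNormalHom E₂ τ := by
  rw [← inv_mul_eq_one, ← map_inv, ← map_mul, absRestrictNormalHom_eq_one_iff_mem_fixingSubgroup₆,
    IntermediateField.fixingSubgroup_sup, Subgroup.mem_inf, ← absRestrictNormalHom_eq_one_iff_mem_fixingSubgroup₆,
    ← absRestrictNormalHom_eq_one_iff_mem_fixingSubgroup₆, map_mul, map_inv, map_mul, map_inv, inv_mul_eq_one, inv_mul_eq_one]

/-- Restriction `Γ_k → Gal(E/k)` is onto. [folklore] -/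
private theorem absRestrictNormalHom_surjective₆ (E : IntermediateField k (AlgebraicClosure k)) [Normal k E] :
    Function.Surjective (absRestrictNormalHom E) := fun g => by
  obtain ⟨σ, hσ⟩ := AlgEquiv.restrictNormalHom_surjective (AlgebraicClosure k) g
  exact ⟨(Field.absoluteGaloisGroup.toAlgEquiv k).symm σ, hσ⟩

/-- `#{m : m^q = 1}` is invariant under isomorphism. [folklore] -/
private theorem natCard_torsion_congr₆ {M M' : Type*} [CommGroup M] [CommGroup M'] (e : M ≃* M') (q : ℕ) :
    Nat.card {m : M // m ^ q = 1} = Nat.card {m : M' // m ^ q = 1} := by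
  refine Nat.card_congr (e.toEquiv.subtypeEquiv fun m => ?_)
  change m ^ q = 1 ↔ e m ^ q = 1
  rw [← map_pow, MulEquiv.map_eq_one_iff]

variable [NumberField k] {p : ℕ} [hp : Fact p.Prime]

/-- `g|_{K_m} = 1 ↔ g ∈ κ⁻¹(pᵐℤ_p)`. [folklore] -/
private theorem absRestrictNormalHom_layer_eq_one_iff₆ (κ : ZpExtension k p) (m : ℕ) [Normal k (κ.layer m)]
    (g : absoluteGaloisGroup k) : absRestrictNormalHom (κ.layer m) g = 1 ↔ g ∈ κ.layerSubgroup m := by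
  rw [absRestrictNormalHom_eq_one_iff_mem_fixingSubgroup₆, κ.fixingSubgroup_layer m]
  constructor
  · rintro ⟨g', hg', hgg'⟩
    have : g' = g := (absoluteGaloisGroup.toAlgEquiv k).injective hgg'
    exact this ▸ hg'
  · exact fun h => ⟨g, h, rfl⟩

omit [NumberField k] in
/-- `γ̃ ∈ Γ_k` with `γ̃|_{L₀} = 1`, `κ(γ̃) = [L₀ : k]`. [folklore] -/
private theorem exists_restrict_eq_one_toAdd_eq₆ (κ : ZpExtension k p)
    (L₀ : IntermediateField k (AlgebraicClosure k)) [FiniteDimensional k L₀] [IsGalois k L₀] :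
    ∃ γ₁ : absoluteGaloisGroup k, absRestrictNormalHom L₀ γ₁ = 1 ∧
      (κ γ₁).toAdd = (Module.finrank k L₀ : ℤ_[p]) := by
  obtain ⟨γ, hγ⟩ := κ.surjective (Multiplicative.ofAdd 1)
  rw [ZpExtension.coe_toContinuousMonoidHom] at hγ
  have hγ1 : (κ γ).toAdd = 1 := by rw [hγ]; rfl
  refine ⟨γ ^ Module.finrank k L₀, ?_, ?_⟩
  · rw [map_pow, ← IsGalois.card_aut_eq_finrank, pow_card_eq_one']
  · rw [map_pow, toAdd_pow, hγ1, nsmul_eq_mul, mul_one]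

omit [NumberField k] in
/-- `Γ_k = Γ_n · γ̃^ℕ`. [folklore] -/
private theorem exists_mul_pow_inv_mem_layerSubgroup₆ (κ : ZpExtension k p) {m : ℕ} (hm : ¬ p ∣ m)
    {γ₁ : absoluteGaloisGroup k} (hγ₁ : (κ γ₁).toAdd = (m : ℤ_[p])) (n : ℕ) (τ : absoluteGaloisGroup k) :
    ∃ t : ℕ, τ * (γ₁ ^ t)⁻¹ ∈ κ.layerSubgroup n := by
  have hpr : p.Prime := hp.out
  set a : ℤ_[p] := (κ τ).toAdd with hadef
  set a₀ : ℕ := PadicInt.appr a n with ha₀def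
  have ha₀ : (p : ℤ_[p]) ^ n ∣ a - a₀ := Ideal.mem_span_singleton.mp (PadicInt.appr_spec n a)
  have hcop : Nat.Coprime m (p ^ n) := (Nat.coprime_comm.mp (hpr.coprime_iff_not_dvd.mpr hm)).pow_right _
  obtain ⟨t, -, ht⟩ := Nat.exists_mul_mod_eq_of_coprime a₀ hcop (pow_ne_zero _ hpr.ne_zero)
  have hmt : (p : ℤ_[p]) ^ n ∣ (a₀ : ℤ_[p]) - ((m * t : ℕ) : ℤ_[p]) := by
    have h1 := map_dvd (Int.castRingHom ℤ_[p]) (Nat.modEq_iff_dvd.mp ht)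
    push_cast at h1
    exact_mod_cast h1
  refine ⟨t, ?_⟩
  rw [ZpExtension.mem_layerSubgroup, map_mul, map_inv, map_pow, toAdd_mul, toAdd_inv, toAdd_pow, hγ₁, nsmul_eq_mul]
  have e : a + -((t : ℤ_[p]) * (m : ℤ_[p])) = (a - a₀) + ((a₀ : ℤ_[p]) - ((m * t : ℕ) : ℤ_[p])) := by
    push_cast; ring
  rw [e]
  exact dvd_add ha₀ hmt

/-! ### `#S̃_n = #S` and the fixed field of `S̃_n` -/

set_option maxHeartbeats 1600000 in
set_option synthInstance.maxHeartbeats 200000 in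
/-- **`#S̃_n = #S`**: the restriction to `L₀K_n` of `{τ ∈ Gal(k̄/K_n) : τ|_{L₀} ∈ S}` has as many elements as `S` (an element of
`Gal(L₀K_n/k)` trivial on `K_n` is determined by its restriction to `L₀`, and every `g ∈ Gal(L₀/k)` lifts into `Gal(k̄/K_n)`).
[cite: Washington1997, §13.1] -/
theorem card_layerImage_eq (κ : ZpExtension k p)
    (L₀ : IntermediateField k (AlgebraicClosure k)) [FiniteDimensional k L₀] [IsGalois k L₀]
    (hL₀ : ¬ p ∣ Module.finrank k L₀) [∀ n, IsGalois k (κ.layer n)] (n : ℕ)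
    (S : Subgroup (L₀ ≃ₐ[k] L₀)) [Fintype S]
    (Sn : Subgroup ((L₀ ⊔ κ.layer n : IntermediateField k (AlgebraicClosure k)) ≃ₐ[k]
      (L₀ ⊔ κ.layer n : IntermediateField k (AlgebraicClosure k)))) [Fintype Sn]
    (hSn : Sn = (S.comap ((absRestrictNormalHom L₀).comp (κ.layerSubgroup n).subtype)).map
      ((absRestrictNormalHom (L₀ ⊔ κ.layer n : IntermediateField k (AlgebraicClosure k))).comp
        (κ.layerSubgroup n).subtype)) :
    Fintype.card Sn = Fintype.card S := by
  classical
  haveI hKn : ∀ m, Normal k (κ.layer m) := fun m => inferInstance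
  obtain ⟨γ₁, hγ₁L, hγ₁κ⟩ := exists_restrict_eq_one_toAdd_eq₆ κ L₀
  set πn : ↥(κ.layerSubgroup n) →* (L₀ ≃ₐ[k] L₀) :=
    (absRestrictNormalHom L₀).comp (κ.layerSubgroup n).subtype with hπndef
  set resn : ↥(κ.layerSubgroup n) →* ((L₀ ⊔ κ.layer n : IntermediateField k (AlgebraicClosure k)) ≃ₐ[k]
      (L₀ ⊔ κ.layer n : IntermediateField k (AlgebraicClosure k))) :=
    (absRestrictNormalHom (L₀ ⊔ κ.layer n : IntermediateField k (AlgebraicClosure k))).comp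
      (κ.layerSubgroup n).subtype with hresndef
  have hres_iff : ∀ τ τ' : ↥(κ.layerSubgroup n), resn τ = resn τ' ↔ πn τ = πn τ' := fun τ τ' => by
    change absRestrictNormalHom _ (τ : absoluteGaloisGroup k) = absRestrictNormalHom _ (τ' : absoluteGaloisGroup k) ↔
      absRestrictNormalHom L₀ (τ : absoluteGaloisGroup k) = absRestrictNormalHom L₀ (τ' : absoluteGaloisGroup k)
    rw [absRestrictNormalHom_sup_eq_iff₆]
    constructor
    · exact fun h => h.1
    · intro h
      refine ⟨h, ?_⟩
      rw [(absRestrictNormalHom_layer_eq_one_iff₆ κ n _).mpr τ.2, (absRestrictNormalHom_layer_eq_one_iff₆ κ n _).mpr τ'.2]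
  have hπsurj : Function.Surjective πn := fun g => by
    obtain ⟨τ₀, hτ₀⟩ := absRestrictNormalHom_surjective₆ L₀ g
    obtain ⟨t, ht⟩ := exists_mul_pow_inv_mem_layerSubgroup₆ κ hL₀ hγ₁κ n τ₀
    refine ⟨⟨τ₀ * (γ₁ ^ t)⁻¹, ht⟩, ?_⟩
    change absRestrictNormalHom L₀ (τ₀ * (γ₁ ^ t)⁻¹) = g
    rw [map_mul, map_inv, map_pow, hγ₁L, one_pow, inv_one, mul_one, hτ₀]
  set s : (L₀ ≃ₐ[k] L₀) → ↥(κ.layerSubgroup n) := Function.surjInv hπsurj with hsdef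
  have hs : ∀ g, πn (s g) = g := Function.surjInv_eq hπsurj
  apply le_antisymm
  · have hex : ∀ y : Sn, ∃ τ : ↥(κ.layerSubgroup n), πn τ ∈ S ∧ resn τ = y.1 := fun y => by
      have hy : y.1 ∈ (S.comap πn).map resn := by rw [← hSn]; exact y.2
      rw [Subgroup.mem_map] at hy
      obtain ⟨τ, hτ, hτy⟩ := hy
      exact ⟨τ, Subgroup.mem_comap.mp hτ, hτy⟩
    choose τy hτyS hτyres using hex
    refine Fintype.card_le_of_injective (fun y => (⟨πn (τy y), hτyS y⟩ : S)) fun y y' hyy' => ?_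
    have h1 : πn (τy y) = πn (τy y') := congrArg Subtype.val hyy'
    rw [← hres_iff, hτyres, hτyres] at h1
    exact Subtype.ext h1
  · have hmem : ∀ x : S, resn (s x) ∈ Sn := fun x => by
      rw [hSn, Subgroup.mem_map]
      exact ⟨s x, Subgroup.mem_comap.mpr (by rw [hs]; exact x.2), rfl⟩
    refine Fintype.card_le_of_injective (fun x => (⟨resn (s x), hmem x⟩ : Sn)) fun x x' hxx' => ?_
    have h1 : resn (s x) = resn (s x') := congrArg Subtype.val hxx'
    rw [hres_iff, hs, hs] at h1
    exact Subtype.ext h1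

set_option maxHeartbeats 1600000 in
set_option synthInstance.maxHeartbeats 200000 in
/-- **`#Cl((L₀K_n)^{S̃_n})[p] = p ^ rank_p Cl((L₀^S·K_∞)_n)`**: the fixed field of `S̃_n` in `L₀K_n` is `j(L₀^S)·K_n` (it is fixed pointwise
by the lifts, and `[L₀K_n : j(L₀^S)K_n] = #S = #S̃_n`), which is `k`-isomorphic to the `n`-th layer of the restricted tower `κ|_{L₀^S}`
(tree `nonempty_algEquiv_layer_restrict_fieldRange_sup_layer`). [cite: Washington1997, §13.1] -/
theorem natCard_torsion_fixedField_layerImage_eq_pow (κ : ZpExtension k p)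
    (L₀ : IntermediateField k (AlgebraicClosure k)) [FiniteDimensional k L₀] [IsGalois k L₀]
    (hL₀ : ¬ p ∣ Module.finrank k L₀) [∀ n, FiniteDimensional k (κ.layer n)] [∀ n, IsGalois k (κ.layer n)]
    [NumberField L₀] (n : ℕ) [NumberField (L₀ ⊔ κ.layer n : IntermediateField k (AlgebraicClosure k))]
    (S : Subgroup (L₀ ≃ₐ[k] L₀)) [Fintype S]
    (Sn : Subgroup ((L₀ ⊔ κ.layer n : IntermediateField k (AlgebraicClosure k)) ≃ₐ[k] (L₀ ⊔ κ.layer n : IntermediateField k (AlgebraicClosure k)))) [Fintype Sn]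
    (hSn : Sn = (S.comap ((absRestrictNormalHom L₀).comp (κ.layerSubgroup n).subtype)).map
      ((absRestrictNormalHom (L₀ ⊔ κ.layer n : IntermediateField k (AlgebraicClosure k))).comp (κ.layerSubgroup n).subtype))
    (hS : Function.Surjective (κ.toContinuousMonoidHom.comp (absGaloisRestrict k ↥(fixedField S)))) :
    Nat.card {d : ClassGroup (𝓞 ↥(fixedField Sn)) // d ^ p = 1} =
      p ^ classGroupPRank (κ.restrict ↥(fixedField S) hS) n := by
  classical
  haveI hKn : ∀ m, Normal k (κ.layer m) := fun m => inferInstance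
  haveI : FiniteDimensional k (L₀ ⊔ κ.layer n : IntermediateField k (AlgebraicClosure k)) := IntermediateField.finiteDimensional_sup L₀ (κ.layer n)
  let j : ↥(fixedField S) →ₐ[k] AlgebraicClosure k := L₀.val.comp (fixedField S).val
  have hj : ∀ z : ↥(fixedField S), j z = ((z : L₀) : AlgebraicClosure k) := fun _ => rfl
  have hjle : j.fieldRange ≤ L₀ := by
    rintro _ ⟨z, rfl⟩
    exact (z : L₀).2
  have hA : j.fieldRange ⊔ κ.layer n ≤ (L₀ ⊔ κ.layer n : IntermediateField k (AlgebraicClosure k)) := sup_le_sup_right hjle _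
  -- (1) `j(L₀^S)K_n ≤ (L₀K_n)^{S̃_n}`
  have hle : IntermediateField.restrict hA ≤ fixedField Sn := by
    intro x hx
    rw [IntermediateField.mem_restrict] at hx
    rw [IntermediateField.mem_fixedField_iff]
    intro h hh
    have hh' : h ∈ (S.comap ((absRestrictNormalHom L₀).comp (κ.layerSubgroup n).subtype)).map
        ((absRestrictNormalHom (L₀ ⊔ κ.layer n : IntermediateField k (AlgebraicClosure k))).comp (κ.layerSubgroup n).subtype) := by rw [← hSn]; exact hh
    rw [Subgroup.mem_map] at hh'
    obtain ⟨τ, hτ, rfl⟩ := hh'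
    have hτS : absRestrictNormalHom L₀ (τ : absoluteGaloisGroup k) ∈ S := Subgroup.mem_comap.mp hτ
    apply Subtype.ext
    change ((absRestrictNormalHom (L₀ ⊔ κ.layer n : IntermediateField k (AlgebraicClosure k)) (τ : absoluteGaloisGroup k) x : (L₀ ⊔ κ.layer n : IntermediateField k (AlgebraicClosure k))) : AlgebraicClosure k) = x
    rw [coe_absRestrictNormalHom_apply₆]
    have hfix : absoluteGaloisGroup.toAlgEquiv k (τ : absoluteGaloisGroup k) ∈ (j.fieldRange ⊔ κ.layer n).fixingSubgroup := by
      rw [IntermediateField.fixingSubgroup_sup, Subgroup.mem_inf]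
      constructor
      · rw [IntermediateField.mem_fixingSubgroup_iff]
        rintro _ ⟨z, rfl⟩
        change (τ : absoluteGaloisGroup k) • j z = j z
        rw [hj, ← coe_absRestrictNormalHom_apply₆ L₀]
        have h1 := (IntermediateField.mem_fixedField_iff S (z : L₀)).mp z.2 _ hτS
        rw [h1]
      · rw [κ.fixingSubgroup_layer n]
        exact Subgroup.mem_map_of_mem _ τ.2
    exact (IntermediateField.mem_fixingSubgroup_iff _ _).mp hfix _ hx
  -- (2) degrees
  have hcard := card_layerImage_eq κ L₀ hL₀ n S Sn hSn
  have eA : ↥(j.fieldRange ⊔ κ.layer n) ≃ₐ[k] ↥(IntermediateField.restrict hA) := IntermediateField.restrict_algEquiv hA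
  have hdA : Module.finrank k ↥(IntermediateField.restrict hA) = Module.finrank k ↥(fixedField S) * p ^ n := by
    rw [← eA.toLinearEquiv.finrank_eq, finrank_fieldRange_sup_layer κ ↥(fixedField S) hS j n]
  have hL₀surj := surjective_comp_absGaloisRestrict_of_not_dvd_finrank κ ↥L₀ hL₀
  have hdL : Module.finrank k (L₀ ⊔ κ.layer n : IntermediateField k (AlgebraicClosure k)) = Module.finrank k L₀ * p ^ n := by
    have h1 := finrank_fieldRange_sup_layer κ ↥L₀ hL₀surj L₀.val n
    have hv : L₀.val.fieldRange ⊔ κ.layer n = L₀ ⊔ κ.layer n := by rw [IntermediateField.fieldRange_val]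
    rw [← (IntermediateField.equivOfEq hv).toLinearEquiv.finrank_eq]
    exact h1
  have hdS : Module.finrank ↥(fixedField S) L₀ = Fintype.card S := by
    rw [IntermediateField.finrank_fixedField_eq_card, Nat.card_eq_fintype_card]
  have hdSn : Module.finrank ↥(fixedField Sn) (L₀ ⊔ κ.layer n : IntermediateField k (AlgebraicClosure k)) = Fintype.card Sn := by
    rw [IntermediateField.finrank_fixedField_eq_card, Nat.card_eq_fintype_card]
  have htow1 := Module.finrank_mul_finrank k ↥(fixedField Sn) (L₀ ⊔ κ.layer n : IntermediateField k (AlgebraicClosure k))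
  have htow2 := Module.finrank_mul_finrank k ↥(fixedField S) ↥L₀
  have hfin : Module.finrank k ↥(IntermediateField.restrict hA) = Module.finrank k ↥(fixedField Sn) := by
    have hpos : 0 < Fintype.card S := Fintype.card_pos
    apply Nat.eq_of_mul_eq_mul_right hpos
    rw [hdA, ← hcard, ← hdSn, htow1, hdL, ← htow2, hdS, hdSn, hcard, Nat.mul_right_comm]
  have hE : IntermediateField.restrict hA = fixedField Sn := IntermediateField.eq_of_le_of_finrank_eq hle hfin
  -- (3) transport
  obtain ⟨e₃⟩ := nonempty_algEquiv_layer_restrict_fieldRange_sup_layer κ ↥(fixedField S) hS j n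
  have etot : ↥((κ.restrict ↥(fixedField S) hS).layer n) ≃ₐ[k] ↥(fixedField Sn) :=
    e₃.trans (eA.trans (IntermediateField.equivOfEq hE))
  rw [← natCard_torsion_classGroup_layer_eq (κ.restrict ↥(fixedField S) hS) n]
  exact (natCard_torsion_congr₆ (ClassGroup.mulEquiv (RingOfIntegers.mapRingEquiv etot.toRingEquiv)) p).symm

set_option maxHeartbeats 1600000 in
set_option synthInstance.maxHeartbeats 200000 in
/-- **The `p`-ranks of the class groups agree at every layer of the cyclotomic towers of `L₀^H` and `L₀^{H′}`** under the
hypotheses of the rank-equality transfer (rank equality at the bottom, saturated inertia condition).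
[cite: Washington1997, §13.3 Prop. 13.23 and Thm. 10.4] -/
theorem classGroupPRank_restrict_fixedField_eq_of_saturated (hp2 : p ≠ 2) (κ : ZpExtension k p)
    (L₀ : IntermediateField k (AlgebraicClosure k)) [FiniteDimensional k L₀] [IsGalois k L₀]
    (hL₀ : ¬ p ∣ Module.finrank k L₀)
    [∀ n, FiniteDimensional k (κ.layer n)] [∀ n, IsGalois k (κ.layer n)]
    [∀ n, NumberField (L₀ ⊔ κ.layer n : IntermediateField k (AlgebraicClosure k))]
    (hram : ∃ 𝔓' : Ideal (absIntegers (𝓞 k) k), 𝔓'.IsMaximal ∧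
      𝔓'.inertia (absoluteGaloisGroup k) ⊔ κ.kerSubgroup = ⊤)
    (H H' : Subgroup (L₀ ≃ₐ[k] L₀)) (hHH' : H ≤ H') [Fintype H] [Fintype H'] (hpH' : ¬ p ∣ Fintype.card H')
    [NumberField L₀]
    (hrank : Nat.card {d : ClassGroup (𝓞 ↥(fixedField H)) // d ^ p = 1} =
      Nat.card {d : ClassGroup (𝓞 ↥(fixedField H')) // d ^ p = 1})
    (hI : ∀ (𝔮 : Ideal (𝓞 L₀)) [𝔮.IsMaximal], ((p : ℕ) : 𝓞 L₀) ∈ 𝔮 →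
      ∀ g : L₀ ≃ₐ[k] L₀, ∀ h' ∈ H', ∃ i ∈ 𝔮.inertia (L₀ ≃ₐ[k] L₀), ∃ h ∈ H, g * h' = i * g * h)
    (hF : Function.Surjective (κ.toContinuousMonoidHom.comp (absGaloisRestrict k ↥(fixedField H))))
    (hF' : Function.Surjective (κ.toContinuousMonoidHom.comp (absGaloisRestrict k ↥(fixedField H'))))
    (n : ℕ) :
    classGroupPRank (κ.restrict ↥(fixedField H) hF) n = classGroupPRank (κ.restrict ↥(fixedField H') hF') n := by
  classical
  haveI : FiniteDimensional k (L₀ ⊔ κ.layer n : IntermediateField k (AlgebraicClosure k)) := IntermediateField.finiteDimensional_sup L₀ (κ.layer n)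
  set Hn : Subgroup ((L₀ ⊔ κ.layer n : IntermediateField k (AlgebraicClosure k)) ≃ₐ[k] (L₀ ⊔ κ.layer n : IntermediateField k (AlgebraicClosure k))) :=
    (H.comap ((absRestrictNormalHom L₀).comp (κ.layerSubgroup n).subtype)).map
      ((absRestrictNormalHom (L₀ ⊔ κ.layer n : IntermediateField k (AlgebraicClosure k))).comp (κ.layerSubgroup n).subtype) with hHn
  set H'n : Subgroup ((L₀ ⊔ κ.layer n : IntermediateField k (AlgebraicClosure k)) ≃ₐ[k] (L₀ ⊔ κ.layer n : IntermediateField k (AlgebraicClosure k))) :=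
    (H'.comap ((absRestrictNormalHom L₀).comp (κ.layerSubgroup n).subtype)).map
      ((absRestrictNormalHom (L₀ ⊔ κ.layer n : IntermediateField k (AlgebraicClosure k))).comp (κ.layerSubgroup n).subtype) with hH'n
  haveI : Fintype Hn := Fintype.ofFinite _
  haveI : Fintype H'n := Fintype.ofFinite _
  have h1 := natCard_torsion_classGroup_fixedField_layer_eq_of_saturated hp2 κ L₀ hL₀ hram H H' hHH' hpH' hrank hI n
    Hn H'n hHn hH'n
  rw [natCard_torsion_fixedField_layerImage_eq_pow κ L₀ hL₀ n H Hn hHn hF,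
    natCard_torsion_fixedField_layerImage_eq_pow κ L₀ hL₀ n H' H'n hH'n hF'] at h1
  exact Nat.pow_right_injective hp.out.two_le h1

/-- **`μ = 0` transfers: `ClassicalMuVanishes κ|_{L₀^{H′}} → ClassicalMuVanishes κ|_{L₀^H}`** (bounded `p`-ranks at every layer,
tree `classicalMuVanishes_iff_exists_forall_classGroupPRank_le`). [cite: Washington1997, §13.3 Prop. 13.23] -/
theorem classicalMuVanishes_restrict_fixedField_of_saturated (hp2 : p ≠ 2) (κ : ZpExtension k p)
    (L₀ : IntermediateField k (AlgebraicClosure k)) [FiniteDimensional k L₀] [IsGalois k L₀]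
    (hL₀ : ¬ p ∣ Module.finrank k L₀)
    [∀ n, FiniteDimensional k (κ.layer n)] [∀ n, IsGalois k (κ.layer n)]
    [∀ n, NumberField (L₀ ⊔ κ.layer n : IntermediateField k (AlgebraicClosure k))]
    (hram : ∃ 𝔓' : Ideal (absIntegers (𝓞 k) k), 𝔓'.IsMaximal ∧
      𝔓'.inertia (absoluteGaloisGroup k) ⊔ κ.kerSubgroup = ⊤)
    (H H' : Subgroup (L₀ ≃ₐ[k] L₀)) (hHH' : H ≤ H') [Fintype H] [Fintype H'] (hpH' : ¬ p ∣ Fintype.card H')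
    [NumberField L₀]
    (hrank : Nat.card {d : ClassGroup (𝓞 ↥(fixedField H)) // d ^ p = 1} =
      Nat.card {d : ClassGroup (𝓞 ↥(fixedField H')) // d ^ p = 1})
    (hI : ∀ (𝔮 : Ideal (𝓞 L₀)) [𝔮.IsMaximal], ((p : ℕ) : 𝓞 L₀) ∈ 𝔮 →
      ∀ g : L₀ ≃ₐ[k] L₀, ∀ h' ∈ H', ∃ i ∈ 𝔮.inertia (L₀ ≃ₐ[k] L₀), ∃ h ∈ H, g * h' = i * g * h)
    (hF : Function.Surjective (κ.toContinuousMonoidHom.comp (absGaloisRestrict k ↥(fixedField H))))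
    (hF' : Function.Surjective (κ.toContinuousMonoidHom.comp (absGaloisRestrict k ↥(fixedField H'))))
    (hμ : ClassicalMuVanishes (κ.restrict ↥(fixedField H') hF')) :
    ClassicalMuVanishes (κ.restrict ↥(fixedField H) hF) := by
  obtain ⟨B, hB⟩ := (classicalMuVanishes_iff_exists_forall_classGroupPRank_le _).mp hμ
  exact classicalMuVanishes_of_forall_classGroupPRank_le _ (B := B) fun m => by
    rw [classGroupPRank_restrict_fixedField_eq_of_saturated hp2 κ L₀ hL₀ hram H H' hHH' hpH' hrank hI hF hF' m]
    exact hB m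

omit [NumberField k] hp in
/-- `p ∤ [L₀^S : k]` when `p ∤ [L₀ : k]`. [folklore] -/
private theorem not_dvd_finrank_fixedField₆ (L₀ : IntermediateField k (AlgebraicClosure k)) [FiniteDimensional k L₀]
    (hp' : ¬ p ∣ Module.finrank k L₀) (S : Subgroup (L₀ ≃ₐ[k] L₀)) : ¬ p ∣ Module.finrank k ↥(fixedField S) := fun h =>
  hp' (h.trans (Dvd.intro _ (Module.finrank_mul_finrank k ↥(fixedField S) L₀)))

/-- **Consumer form (cyclotomic towers): `μ_p(L₀^{H′}) = 0 ⟹ μ_p(L₀^H) = 0`** — for `κ` cyclotomic on `k` (with a totally ramified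
prime) and every cyclotomic `ℤ_p`-extension of the leaves; hypotheses as in the rank-equality transfer (rank equality at the bottom,
saturated inertia condition).  This is the door of the cell's μ-road census: the μ-invariant of a big leaf `L₀^H` (e.g. `ℚ(P)`) is read
on a small sub-leaf `L₀^{H′}` (e.g. `ℚ(x(P))`) whenever their `p`-ranks agree. [cite: Washington1997, §13.3 Prop. 13.23 and Thm. 10.4] -/
theorem classicalMuVanishes_of_isCyclotomic_fixedField_of_saturated (hp2 : p ≠ 2) (κ : ZpExtension k p) (hκ : κ.IsCyclotomic)
    (L₀ : IntermediateField k (AlgebraicClosure k)) [FiniteDimensional k L₀] [IsGalois k L₀]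
    (hL₀ : ¬ p ∣ Module.finrank k L₀)
    [∀ n, FiniteDimensional k (κ.layer n)] [∀ n, IsGalois k (κ.layer n)]
    [∀ n, NumberField (L₀ ⊔ κ.layer n : IntermediateField k (AlgebraicClosure k))]
    (hram : ∃ 𝔓' : Ideal (absIntegers (𝓞 k) k), 𝔓'.IsMaximal ∧
      𝔓'.inertia (absoluteGaloisGroup k) ⊔ κ.kerSubgroup = ⊤)
    (H H' : Subgroup (L₀ ≃ₐ[k] L₀)) (hHH' : H ≤ H') [Fintype H] [Fintype H'] (hpH' : ¬ p ∣ Fintype.card H')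
    [NumberField L₀]
    (hrank : Nat.card {d : ClassGroup (𝓞 ↥(fixedField H)) // d ^ p = 1} =
      Nat.card {d : ClassGroup (𝓞 ↥(fixedField H')) // d ^ p = 1})
    (hI : ∀ (𝔮 : Ideal (𝓞 L₀)) [𝔮.IsMaximal], ((p : ℕ) : 𝓞 L₀) ∈ 𝔮 →
      ∀ g : L₀ ≃ₐ[k] L₀, ∀ h' ∈ H', ∃ i ∈ 𝔮.inertia (L₀ ≃ₐ[k] L₀), ∃ h ∈ H, g * h' = i * g * h)
    (hμ : ∀ κE : ZpExtension ↥(fixedField H') p, κE.IsCyclotomic → ClassicalMuVanishes κE)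
    (κE : ZpExtension ↥(fixedField H) p) (hκE : κE.IsCyclotomic) : ClassicalMuVanishes κE := by
  have hF := surjective_comp_absGaloisRestrict_of_not_dvd_finrank κ ↥(fixedField H)
    (not_dvd_finrank_fixedField₆ L₀ hL₀ H)
  have hF' := surjective_comp_absGaloisRestrict_of_not_dvd_finrank κ ↥(fixedField H')
    (not_dvd_finrank_fixedField₆ L₀ hL₀ H')
  have h1 := classicalMuVanishes_restrict_fixedField_of_saturated hp2 κ L₀ hL₀ hram H H' hHH' hpH' hrank hI hF hF'
    (hμ _ (isCyclotomic_restrict κ hκ _ hF'))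
  exact (classicalMuVanishes_iff_of_isCyclotomic _ _ (isCyclotomic_restrict κ hκ _ hF) hκE).mp h1

end RankEqualityTransfer

end Literature.NumberTheory.NumberFields

end
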